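/-
PORT (pub-hodgecm2, COR-CM cell) of the stage-1 package file `HodgeCMPerL/HodgeCM/CM/LefschetzChar.lean`
(pub-hodgecm HOME/lean, bytes of record md5 1530b8b90fc9, 435 lines). Declarations VERBATIM; edits: imports rewritten to tree
modules, namespace token `HodgeCM` ↦ `Summit.HodgeConjecture.CorCM`, package `conjRingHomK` ↦ tree `Literature.NumberTheory.Automorphic.cmConjRingHom`
(definitionally equal bodies), linter fixes. Generator: pub-hodgecm2-p1 `work/port/build_kit.py`.
-/
/-
Copyright: pub-hodgecm formalisation cell (harness21, 2026). New file (not vendored).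
-/
import Summits.HodgeConjecture.CorCM.CM.Basic
import Summits.HodgeConjecture.CorCM.Prior.AllgGroup2

/-!
# The Lefschetz character of a weight and the face dictionary (rfwf §8 / [QW8] §2 / COR-CM (a),(b4))

Pure CM-combinatorics (no geometry).  For a GALOIS CM field `F`:

* `galTranslates F` — the group `E` of permutations of `Hom(F, ℂ)` commuting with `Aut(F)` acting by
  pre-composition; these are exactly the maps `σ ↦ τ ∘ σ` for `τ ∈ Aut(ℂ/ℚ)` (F Galois), and complex
  conjugation `conjT` is a central involution in it.  `E` acts simply transitively on `Hom(F, ℂ)`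
  (`embOfAut`, `translate`).
* `pullType Θ s : CMF E conjT` — the CM type `Θ` read in the group along the base point `s`
  (`{P | P s ∈ Θ}`); this is the "`Θ s⁻¹`" of COR-CM (b4).
* `Asym F` — the value group `ℤ[types of (E, c)] / ⟨[Ψ] + [Ψ̄]⟩` of the Lefschetz character and
  `abar` the quotient map ("ā kills pairs", COR-CM row 9).
* `lefChar Θ S` — the Lefschetz character `a(e_S) = Σ_j Σ_{s ∈ S_j} ā[Θ_j s⁻¹]` of a weight
  `S = (S_j)` on `∏_j A_{(F,Θ_j)}` ([QW8] Def. 2.3).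
* `IsHodgeWeight Θ p S` — `|S| = 2p` and every Galois translate of the monomial `e_S` has Hodge type
  `(p,p)` (Pohlmann's condition).
* MAIN THEOREM `lefChar_eq_sum_faces`: for a Hodge weight, `a(e_S)` is an INTEGER combination of the
  Lefschetz characters of rank-four face Weil classes `lefChar f.corner (fun _ ↦ {σ₀})` — from the lattice
  statement `l:allg` (`Summit.HodgeConjecture.CorCM.Prior.AllgGroup.RfwfAllgGroup.gfaces_generate`, machine-checked for all `g`)
  transported along the torsor `Hom(F,ℂ) ≃ E`, plus the dictionary "corners of a face ↦ face relation"
  (`faceOfG`, `lefChar_corner_faceOfG`); the intermediate form over group-level face relations is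
  `lefChar_eq_sum_gface` and the membership `r(e_S) − p·pair ∈ R_F` is `weightRel_sub_mem_ker`.
-/

noncomputable section

open NumberField NumberField.ComplexEmbedding
open scoped symmDiff

namespace Summit.HodgeConjecture.CorCM

open Literature.AlgebraicGeometry.Motives (CMType)
open Literature.NumberTheory.ComplexMultiplication.CMTypeOps
open Summit.HodgeConjecture.CorCM.Prior.AllgGroup.RfwfAllgGroup

/-! ### Galois translates of embeddings -/

section GalT

variable (F : Type) [Field F] [NumberField F]

/-- A permutation of `Hom(F, ℂ)` is a **Galois translate** if it commutes with the right action of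
`Aut(F/ℚ)` by pre-composition (for `F` Galois these are the maps `σ ↦ τ ∘ σ`, `τ ∈ Aut(ℂ/ℚ)`). -/
def IsGalTranslate (P : Equiv.Perm (F →+* ℂ)) : Prop :=
  ∀ (σ : F →+* ℂ) (g : F ≃ₐ[ℚ] F), P (σ.comp (g : F →+* F)) = (P σ).comp (g : F →+* F)

/-- The group `E` of Galois translates. -/
def galTranslates : Subgroup (Equiv.Perm (F →+* ℂ)) where
  carrier := {P | IsGalTranslate F P}
  mul_mem' := by
    intro P Q hP hQ σ g
    simp only [Equiv.Perm.coe_mul, Function.comp_apply]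
    rw [hQ, hP]
  one_mem' := by
    intro σ g
    simp
  inv_mem' := by
    intro P hP σ g
    apply P.injective
    rw [Equiv.Perm.coe_inv, Equiv.apply_symm_apply, hP, Equiv.apply_symm_apply]

/-- The group of Galois translates as a type. -/
abbrev GalT : Type := ↥(galTranslates F)

/-- `GalT F` (the Galois translates of embeddings) is finite. -/
instance : Fintype (GalT F) := by
  classical exact Fintype.ofFinite _

/-- Decidable equality on `GalT F` (classical). -/
instance : DecidableEq (GalT F) := by
  classical exact inferInstance

variable {F}

/-- A Galois translate commutes with precomposition by a field automorphism (its defining property). -/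
theorem GalT.apply_comp (P : GalT F) (σ : F →+* ℂ) (g : F ≃ₐ[ℚ] F) :
    P.1 (σ.comp (g : F →+* F)) = (P.1 σ).comp (g : F →+* F) :=
  P.2 σ g

/-- Multiplication in `GalT F` is composition of the underlying maps on embeddings. -/
@[simp] theorem GalT.mul_apply (P Q : GalT F) (σ : F →+* ℂ) : (P * Q).1 σ = P.1 (Q.1 σ) := rfl

/-- The unit of `GalT F` acts as the identity on embeddings. -/
@[simp] theorem GalT.one_apply (σ : F →+* ℂ) : (1 : GalT F).1 σ = σ := rfl

/-- Complex conjugation is a Galois translate (it is even central). -/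
def conjT : GalT F :=
  ⟨Function.Involutive.toPerm _ (involutive_conjugate F), by
    intro σ g
    simp only [Function.Involutive.coe_toPerm]
    ext x
    simp [conjugate_coe_eq]⟩

/-- `conjT` acts on an embedding by complex conjugation. -/
@[simp] theorem conjT_apply (σ : F →+* ℂ) : (conjT : GalT F).1 σ = conjugate σ := rfl

/-- `conjT` is an involution: `conjT * conjT = 1`. -/
theorem conjT_mul_self : (conjT : GalT F) * conjT = 1 := by
  apply Subtype.ext
  ext σ : 1
  simp [involutive_conjugate F σ]

/-- For a totally complex field, complex conjugation is a non-trivial Galois translate. -/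
theorem conjT_ne_one [IsTotallyComplex F] : (conjT : GalT F) ≠ 1 := by
  intro h
  obtain ⟨σ⟩ : Nonempty (F →+* ℂ) := by
    have hc : 0 < Fintype.card (F →+* ℂ) := by
      rw [Embeddings.card]; exact Module.finrank_pos
    exact Fintype.card_pos_iff.mp hc
  have h1 : conjugate σ = σ := by
    have := congrArg (fun P : GalT F => P.1 σ) h
    simpa using this
  exact IsTotallyComplex.complexEmbedding_not_isReal σ (ComplexEmbedding.isReal_iff.mpr h1)

/-- Cancellation `conjT * (conjT * P) = P`. -/
theorem conjT_mul_conjT_mul (P : GalT F) : conjT * (conjT * P) = P := by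
  rw [← mul_assoc, conjT_mul_self, one_mul]

/-! ### The torsor `Hom(F, ℂ) ≃ Aut(F)` (F Galois) and simple transitivity of `E` -/

/-- `g ↦ σ₀ ∘ g` is injective. -/
theorem comp_aut_injective (σ₀ : F →+* ℂ) :
    Function.Injective (fun g : F ≃ₐ[ℚ] F => σ₀.comp (g : F →+* F)) := by
  intro g g' h
  ext x
  have := RingHom.congr_fun h x
  simp only [RingHom.coe_comp, RingHom.coe_coe, Function.comp_apply] at this
  exact σ₀.injective this

/-- For `F` Galois, `g ↦ σ₀ ∘ g` is a bijection `Aut(F) ≃ Hom(F, ℂ)`. -/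
theorem comp_aut_bijective [IsGalois ℚ F] (σ₀ : F →+* ℂ) :
    Function.Bijective (fun g : F ≃ₐ[ℚ] F => σ₀.comp (g : F →+* F)) := by
  classical
  rw [Fintype.bijective_iff_injective_and_card]
  refine ⟨comp_aut_injective σ₀, ?_⟩
  rw [Embeddings.card, ← Nat.card_eq_fintype_card]
  exact IsGalois.card_aut_eq_finrank ℚ F

/-- The bijection `Aut(F) ≃ Hom(F, ℂ)`, `g ↦ σ₀ ∘ g`. -/
def embOfAut [IsGalois ℚ F] (σ₀ : F →+* ℂ) : (F ≃ₐ[ℚ] F) ≃ (F →+* ℂ) :=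
  Equiv.ofBijective _ (comp_aut_bijective σ₀)

/-- `embOfAut σ₀ g = σ₀ ∘ g`: the embedding obtained from `σ₀` by the automorphism `g`. -/
@[simp] theorem embOfAut_apply [IsGalois ℚ F] (σ₀ : F →+* ℂ) (g : F ≃ₐ[ℚ] F) :
    embOfAut σ₀ g = σ₀.comp (g : F →+* F) := rfl

/-- For `F/ℚ` Galois every complex embedding is `σ₀ ∘ g` for some automorphism `g` (transitivity). -/
theorem exists_aut_eq [IsGalois ℚ F] (σ₀ ρ : F →+* ℂ) : ∃ g : F ≃ₐ[ℚ] F, ρ = σ₀.comp (g : F →+* F) := by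
  obtain ⟨g, hg⟩ := (embOfAut σ₀).surjective ρ
  exact ⟨g, hg.symm⟩

/-- A Galois translate is determined by its value at one embedding (the action of `E` is free). -/
theorem GalT.ext_of_apply [IsGalois ℚ F] (σ₀ : F →+* ℂ) {P Q : GalT F} (h : P.1 σ₀ = Q.1 σ₀) :
    P = Q := by
  apply Subtype.ext
  ext ρ : 1
  obtain ⟨g, rfl⟩ := exists_aut_eq σ₀ ρ
  rw [GalT.apply_comp, GalT.apply_comp, h]

/-- The Galois translate sending `σ₀` to `ρ`: `σ₀ ∘ g ↦ ρ ∘ g` (the action of `E` is transitive). -/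
def translate [IsGalois ℚ F] (σ₀ ρ : F →+* ℂ) : GalT F :=
  ⟨(embOfAut σ₀).symm.trans (embOfAut ρ), by
    intro σ g
    obtain ⟨g₁, rfl⟩ := exists_aut_eq σ₀ σ
    have e1 : (σ₀.comp (g₁ : F →+* F)).comp (g : F →+* F) = σ₀.comp ((g₁ * g : F ≃ₐ[ℚ] F) : F →+* F) := by
      ext x; simp [AlgEquiv.mul_apply]
    have k1 : (embOfAut σ₀).symm (σ₀.comp (g₁ : F →+* F)) = g₁ :=
      (embOfAut σ₀).symm_apply_eq.mpr rfl
    have k2 : (embOfAut σ₀).symm (σ₀.comp ((g₁ * g : F ≃ₐ[ℚ] F) : F →+* F)) = g₁ * g :=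
      (embOfAut σ₀).symm_apply_eq.mpr rfl
    rw [e1]
    simp only [Equiv.trans_apply, k1, k2, embOfAut_apply]
    ext x; simp [AlgEquiv.mul_apply]⟩

/-- The Galois translate `translate σ₀ ρ` sends the base embedding `σ₀` to `ρ`. -/
@[simp] theorem translate_apply_self [IsGalois ℚ F] (σ₀ ρ : F →+* ℂ) : (translate σ₀ ρ).1 σ₀ = ρ := by
  have k1 : (embOfAut σ₀).symm σ₀ = 1 := (embOfAut σ₀).symm_apply_eq.mpr (by ext x; simp)
  change ((embOfAut σ₀).symm.trans (embOfAut ρ)) σ₀ = ρ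
  simp only [Equiv.trans_apply, k1, embOfAut_apply]
  ext x; simp

end GalT

/-! ### CM types read in the group `E`; the value group `Asym`; the Lefschetz character -/

section Char

variable {F : Type} [Field F] [NumberField F]

attribute [local instance] Classical.propDecidable

/-- `Θ^{(s)} = {P ∈ E | P s ∈ Θ}`: the CM type `Θ ⊆ Hom(F,ℂ)` read in `E` along the base point `s`
(COR-CM (b4): "`Θ s⁻¹`"). -/
def pullType (Θ : CMType F) (s : F →+* ℂ) : CMF (GalT F) conjT :=
  ⟨Finset.univ.filter (fun P : GalT F => P.1 s ∈ Θ.1), by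
    intro P
    simp only [Finset.mem_filter, Finset.mem_univ, true_and, GalT.mul_apply, conjT_apply]
    exact mem_iff_conjugate_notMem Θ (P.1 s)⟩

/-- Membership in the pulled-back type `pullType Θ s`: `P ∈ pullType Θ s ↔ P s ∈ Θ`. -/
@[simp] theorem mem_pullType (Θ : CMType F) (s : F →+* ℂ) (P : GalT F) :
    P ∈ (pullType Θ s).1 ↔ P.1 s ∈ Θ.1 := by
  simp [pullType]

/-- The conjugate type in the group: `Ψ̄ = cΨ = complement`. -/
def barCM (Ψ : CMF (GalT F) conjT) : CMF (GalT F) conjT :=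
  ⟨Finset.univ \ Ψ.1, by
    intro x
    simp only [Finset.mem_sdiff, Finset.mem_univ, true_and, not_not]
    have h := Ψ.2 (conjT * x)
    rw [conjT_mul_conjT_mul] at h
    exact h.symm⟩

/-- Membership in the conjugate abstract CM type `barCM Ψ` is non-membership in `Ψ`. -/
@[simp] theorem mem_barCM (Ψ : CMF (GalT F) conjT) (x : GalT F) : x ∈ (barCM Ψ).1 ↔ x ∉ Ψ.1 := by
  simp [barCM]

/-- The relations `[Ψ] + [Ψ̄]` ("pairs"). -/
def pairRel : Submodule ℤ (CMF (GalT F) conjT →₀ ℤ) :=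
  Submodule.span ℤ {y | ∃ Ψ, y = Finsupp.single Ψ 1 + Finsupp.single (barCM Ψ) 1}

/-- The value group `⊕_O Asym(O) = ℤ[types]/⟨pairs⟩` of the Lefschetz character. -/
abbrev Asym (F : Type) [Field F] [NumberField F] : Type := (CMF (GalT F) conjT →₀ ℤ) ⧸ (pairRel (F := F))

/-- `ā : ℤ[types] → Asym` (COR-CM row 9: "ā kills pairs"). -/
def abar : (CMF (GalT F) conjT →₀ ℤ) →ₗ[ℤ] Asym F := (pairRel (F := F)).mkQ

/-- `ā[Ψ]`. -/
def achar (Ψ : CMF (GalT F) conjT) : Asym F := abar (Finsupp.single Ψ 1)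

/-- The characters of a CM type and of its conjugate sum to zero: `achar Ψ + achar Ψ̄ = 0`. -/
theorem achar_add_achar_bar (Ψ : CMF (GalT F) conjT) : achar Ψ + achar (barCM Ψ) = 0 := by
  unfold achar
  rw [← map_add]
  exact (Submodule.Quotient.mk_eq_zero _).mpr (Submodule.subset_span ⟨Ψ, rfl⟩)

/-- The character of the conjugate type is the negative: `achar Ψ̄ = - achar Ψ`. -/
theorem achar_bar (Ψ : CMF (GalT F) conjT) : achar (barCM Ψ) = -achar Ψ :=
  eq_neg_of_add_eq_zero_right (achar_add_achar_bar Ψ)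

/-- **The Lefschetz character** `a(e_S) = Σ_j Σ_{s ∈ S_j} ā[Θ_j^{(s)}]` of the weight `S = (S_j)_j`
(a set of eigencharacters on each factor) on `∏_j A_{(F, Θ_j)}` ([QW8] Def. 2.3; COR-CM (b4)). -/
def lefChar {n : ℕ} (Θ : Fin (n + 1) → CMType F) (S : Fin (n + 1) → Finset (F →+* ℂ)) : Asym F :=
  ∑ j, ∑ s ∈ S j, achar (pullType (Θ j) s)

/-- **Hodge weights** (Pohlmann's condition): `|S| = 2p` and for every Galois translate `P`,
`#{(j,s) ∈ S : P s ∈ Θ_j} = p` — i.e. every Galois conjugate of the monomial `e_S` has Hodge type `(p,p)`. -/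
def IsHodgeWeight {n : ℕ} (Θ : Fin (n + 1) → CMType F) (p : ℕ) (S : Fin (n + 1) → Finset (F →+* ℂ)) :
    Prop :=
  (∑ j, (S j).card) = 2 * p ∧ ∀ P : GalT F, (∑ j, ∑ s ∈ S j, ind (Θ j) (P.1 s)) = (p : ℤ)

end Char

/-! ### From `l:allg` to the Lefschetz character: the weight relation lies in the face lattice -/

section Main

variable {F : Type} [Field F] [NumberField F]

attribute [local instance] Classical.propDecidable

/-- The type sum of the single pulled-back type `pullType Θ s` at `t` is the indicator `1_Θ(t s)`. -/
theorem typeSum_single_pullType (Θ : CMType F) (s : F →+* ℂ) (t : GalT F) :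
    typeSum (GalT F) conjT (Finsupp.single (pullType Θ s) 1) t = ind Θ (t.1 s) := by
  rw [typeSum_single]
  simp only [indG, ind]
  by_cases h : t.1 s ∈ Θ.1
  · rw [if_pos ((mem_pullType Θ s t).mpr h), if_pos h]
  · rw [if_neg (fun h' => h ((mem_pullType Θ s t).mp h')), if_neg h]

/-- A CM type and its conjugate have constant type sum `1` (the pair relation). -/
theorem typeSum_pair (Ψ : CMF (GalT F) conjT) (t : GalT F) :
    typeSum (GalT F) conjT (Finsupp.single Ψ 1 + Finsupp.single (barCM Ψ) 1) t = 1 := by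
  rw [map_add, Pi.add_apply, typeSum_single, typeSum_single]
  simp only [indG]
  by_cases h : t ∈ Ψ.1
  · rw [if_pos h, if_neg (fun h' => ((mem_barCM Ψ t).mp h') h)]; rfl
  · rw [if_neg h, if_pos ((mem_barCM Ψ t).mpr h)]; rfl

/-- The "weight relation" `r(e_S) = Σ [Θ_j^{(s)}]` of COR-CM (b4). -/
def weightRel {n : ℕ} (Θ : Fin (n + 1) → CMType F) (S : Fin (n + 1) → Finset (F →+* ℂ)) :
    CMF (GalT F) conjT →₀ ℤ :=
  ∑ j, ∑ s ∈ S j, Finsupp.single (pullType (Θ j) s) 1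

/-- The image under `abar` of the weight relation of `(Θ, S)` is the Lefschetz character `lefChar Θ S`. -/
theorem abar_weightRel {n : ℕ} (Θ : Fin (n + 1) → CMType F) (S : Fin (n + 1) → Finset (F →+* ℂ)) :
    abar (weightRel Θ S) = lefChar Θ S := by
  simp only [weightRel, lefChar, map_sum, achar]

/-- COR-CM (b4): for a Hodge weight the weight relation, corrected by `p` pairs, lies in the relation
lattice `R_F = ker(ℤ[types] → ℤ[E])`. -/
theorem weightRel_sub_mem_ker {n : ℕ} (Θ : Fin (n + 1) → CMType F) {p : ℕ}
    (S : Fin (n + 1) → Finset (F →+* ℂ)) (hS : IsHodgeWeight Θ p S) (Ψ₀ : CMF (GalT F) conjT) :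
    weightRel Θ S - (p : ℤ) • (Finsupp.single Ψ₀ 1 + Finsupp.single (barCM Ψ₀) 1) ∈
      LinearMap.ker (typeSum (GalT F) conjT) := by
  rw [LinearMap.mem_ker, map_sub, map_smul]
  funext t
  rw [Pi.sub_apply, Pi.smul_apply, typeSum_pair, Pi.zero_apply, smul_eq_mul, mul_one]
  simp only [weightRel, map_sum, Finset.sum_apply, typeSum_single_pullType]
  rw [hS.2 t, sub_self]

/-- `l:allg` applied: the Lefschetz character of a Hodge weight is an integer combination of the images
`ā(face relation)` of group-level face relations. -/
theorem lefChar_eq_sum_gface [IsTotallyComplex F] {n : ℕ} (Θ : Fin (n + 1) → CMType F) {p : ℕ}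
    (S : Fin (n + 1) → Finset (F →+* ℂ)) (hS : IsHodgeWeight Θ p S) :
    ∃ (m : ℕ) (c : Fin m → ℤ) (y : Fin m → gfaceSet (GalT F) conjT conjT_mul_self),
      lefChar Θ S = ∑ i, c i • abar (y i).1 := by
  have hker := weightRel_sub_mem_ker Θ S hS (pullType (Θ 0) (Classical.arbitrary _))
  rw [← gfaces_generate conjT conjT_mul_self conjT_ne_one] at hker
  obtain ⟨m, c, y, hy⟩ := Submodule.mem_span_set'.mp hker
  refine ⟨m, c, y, ?_⟩
  have hpair : abar ((p : ℤ) • (Finsupp.single (pullType (Θ 0) (Classical.arbitrary (F →+* ℂ))) 1 +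
      Finsupp.single (barCM (pullType (Θ 0) (Classical.arbitrary (F →+* ℂ)))) 1)) = 0 :=
    (Submodule.Quotient.mk_eq_zero _).mpr (Submodule.smul_mem _ _ (Submodule.subset_span ⟨_, rfl⟩))
  have e := congrArg abar hy
  rw [map_sub, hpair, sub_zero, abar_weightRel, map_sum] at e
  rw [← e]
  refine Finset.sum_congr rfl fun i _ => ?_
  exact map_smul abar (c i) (y i).1

/-! ### The dictionary: corners of a geometric face ↦ a group-level face relation -/

variable [IsGalois ℚ F]

/-- Read a group-level CM type back in `Hom(F, ℂ)` along `σ₀`. -/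
def pushType (σ₀ : F →+* ℂ) (Φ' : CMF (GalT F) conjT) : CMType F :=
  ⟨{ρ | translate σ₀ ρ ∈ Φ'.1}, by
    intro ρ
    have hc : translate σ₀ (conjugate ρ) = conjT * translate σ₀ ρ :=
      GalT.ext_of_apply σ₀ (by simp)
    simp only [Set.mem_setOf_eq, hc]
    exact Φ'.2 _⟩

/-- `translate σ₀ (P σ₀) = P`: a Galois translate is determined by its value at the base embedding. -/
theorem translate_apply_eq (σ₀ : F →+* ℂ) (P : GalT F) : translate σ₀ (P.1 σ₀) = P :=
  GalT.ext_of_apply σ₀ (by simp)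

/-- `pullType` is a left inverse of `pushType` at the base embedding `σ₀`. -/
@[simp] theorem pullType_pushType (σ₀ : F →+* ℂ) (Φ' : CMF (GalT F) conjT) :
    pullType (pushType σ₀ Φ') σ₀ = Φ' := by
  apply Subtype.ext
  ext P
  rw [mem_pullType]
  change translate σ₀ (P.1 σ₀) ∈ Φ'.1 ↔ _
  rw [translate_apply_eq]

omit [IsGalois ℚ F] in
/-- Pulling back the conjugate CM type gives the conjugate abstract type: `pullType Θ̄ σ₀ = barCM (pullType Θ σ₀)`. -/
theorem pullType_bar (Θ : CMType F) (σ₀ : F →+* ℂ) : pullType (bar Θ) σ₀ = barCM (pullType Θ σ₀) := by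
  apply Subtype.ext
  ext P
  rw [mem_pullType, mem_barCM, mem_pullType]
  rfl


end Main
end Summit.HodgeConjecture.CorCM
end
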